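import Literature.MathematicalPhysics.QuantumFieldTheory.Balaban1983to89.B8SectERemainderCovariance

/-!
# `Balaban1983to89.B8SectERemainderTraceFree` — [Balaban1985RegularSpaces] Sect. E / [Balaban1985Averaging] (213): the nonlinear remainder
# `C′_j(u, μ) = log ũ′ʲ − Q′_jμ` IS `τ`-FREE for `τ`-free `μ`, `G`-valued backgrounds and `H`-valued gauge transformations — the binder `hCτ` of
# `B8SectETraceFree` as a theorem (sub-row «G-B8-T2S», JOINT J-SU layer 2e′)

statement-level skeleton of published theorems with citation tags; proofs where landed; nothing here is a claim about the
Yang–Mills mass gap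

T. Bałaban, *Averaging operations for lattice gauge theories*, Commun. Math. Phys. **98** (1985) 17–51 `[Balaban1985Averaging]` ("[3]"): p. 20
(«the group `G` is obtained by applying `e^{iA}` to `A ∈ 𝔤`»), (78)–(80) p. 30, (166)–(167) p. 44, (178) p. 45, Prop. 10 (203)–(204) and
(211)–(213) p. 50.  T. Bałaban, *Spaces of regular gauge field configurations …*, Commun. Math. Phys. **99** (1985) 75–102 `[Balaban1985RegularSpaces]`
("B8"): p. 76 (`G = SU(N)`, `𝔤`), (1.115)–(1.120) p. 96, (1.112) p. 95.  STATUS: published, refereed.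

CITATION HEADER (lean-in-tree rule).  Cell `lit-balaban`, seat `lit-balaban-t2s-1` (gen 0), sub-row «G-B8-T2S» (R3 `stmt-QuantumFields-19200`),
JOINT J-SU (`lit-balaban-t2s-1/J-SU-ROADMAP.md`, layer 2e′).  WHAT IS REPRODUCED.  `B8SectETraceFree.sectE_traceFree` displays the hypothesis `hCτ`:
«[3]'s remainder `C′_j(u₁⁻¹, μ)(y)` is `τ`-free for `τ`-free `μ` on the (1.120)-set of the tower».  THIS FILE proves it, following n04-b's
`B8SectERemainderCovariance` (which pushes the involution `θ(w) = (w⋆)⁻¹` through (78)–(80), (178), (213)) with «membership in a subgroup `H`»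
in place of `θ`-covariance: `H` is any subgroup with (H2) `τ(log h) = 0` for `h ∈ H`, `‖h − 1‖ ≤ ⅛` and (H3) `e^{S} ∈ H` for `τ`-free `S` (for
`M_N(ℂ)`, `τ = tr`: `H = SL(N, ℂ)`, by Liouville `det e^{S} = e^{tr S}` and `ExpMeanLog.trace_mlog_eq_zero_of_det_eq_one`, `N ≤ 25`), the background
is `G`-valued with `G ≤ H` averaging-closed (`SU(N)`, `N ≤ 12`: `B7Prop2SpecialUnitary`) so that the averaged levels `Ū₀ʲ` are `G`-valued (Prop. 2):
* `uavg_mem_tower` — LOCAL `H`-valuedness of `\overline{R₀g}ᵐ` (79)–(80) on the tower `Bʲ(y)` from `H`-valuedness of `g` on the box: (78) is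
  `v(y)·exp[Σ L^{−d} log(v(y)⁻¹R(Ū₀(Γ))v(x))]` with every logarithm of an `H`-element within `⅛` of `1` ((167)), so the exponent is `τ`-free
  ((H2)) and its exponential lies in `H` ((H3)); the block combinatorics is `B8Ineq130.smul_mem ∕ block_mem` as in `B8Ineq172Concrete.uavg_congr_tower`;
* `apply_lamAvgG` — `τ(Q′_jμ) = 0` for `τ`-free `μ` ((211)–(212): real weights, rotations by `τ`-cyclicity);
* ★ `apply_Cnl_of_witness` (tower form) and ★ `apply_Cnl_inv_of_axial` (the shape of `hCτ`, at Theorem 4's `u₁⁻¹`, witness by n04-b's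
  `witness_inv_unitary_of_glev`).
NOT CLAIMED: the `M_N(ℂ)` instances of (H2)/(H3)/`AvgClosed` (tree: `ExpMeanLog`, `B7Prop2SpecialUnitary`, `B13Inv214OrbitSUN.slUnits`; to be threaded
by the route-P server), anything at the socket level.

HONEST SCOPE.  Proofs are n04-b's with subgroup membership in place of `θ`; no new analysis.  Count-neutral; N05 ∕ `stub_PV3A` NOT discharged;
nothing continuum ∕ ℝ⁴ ∕ OS ∕ mass-gap ∕ Clay.  No `sorry`, no `def`, no `… : Prop` fact, no `instance`, no `notation`.
-/

noncomputable section

open NormedSpace Finset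

namespace Literature.MathematicalPhysics.QuantumFieldTheory.Balaban1983to89.B8SectERemainderTraceFree

open B7Prop1Explicit B7Prop2Explicit B7Prop3Flat B7Prop1Local B7Eq167Flat B7Eq167General
open MatrixLog (mlog exp_mlog norm_mlog_le_two_mul)
open B7Eq170Flat (cj cj_apply val_Rc_eq_cj bmean bmean_apply)
open B7Eq92Concrete (Rc Rc_apply mgauge)
open B7Eq99Concrete (R0fun R0fun_apply R0fun_self R0fun_add R0avg savg Sexp savg_apply Sexp_apply)
open B7Eq84Concrete (uavg uavg_zero uavg_succ glev)
open B7Prop9Flat (C5' SiteBd)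
open B7Prop9General (CovBondBd)
open B7Prop10General (C6 C4G utilG prop10_general_of52 levels_of52)
open B7Prop10Flat (one_le_C5 C4'_nonneg C5'_nonneg)
open B7Prop10InLambda (inLambda_mul_of_prop10_general)
open B7Eq214General (rlam rlam_apply lamAvgG lamAvgG_zero lamAvgG_succ)
open B7Prop8PrintedConstants (uavg_mem_unitaryUnits)
open B8Ineq130 (tlo thi inBox_of_le tlo_zero thi_zero)
open B8Eq1115Concrete (utilG_congr_tower lamAvgG_congr_tower)
open B8Eq119TwistedAxial (bgT InAx Restr129)
open B8Eq178Averages (Qnl Qnl_eq_mlog_utilG qprimeIter_bgT_eq_lamAvgG utilG_eq_uavg_mul_inv)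
open B8Eq1123Concrete (Cnl)
open B8Eq1112Quotient (inLambda_inv)
open B9Eq3114Proof (mlog_units_inv)
open B8SectEInLambdaWitness (witness_unitary_of_glev)
open B8SectERemainderCovariance (witness_inv_unitary_of_glev)
open B8Eq1117KLevel (glev_on_towers_of_axial)

-- `Site` alone could resolve to the torus sites of `Setup.lean`; re-export the `ℤ^d` sites of `B7Prop1Explicit`.
export B7Prop1Explicit (Site)

variable {d : ℕ}
variable {𝔸 : Type*} [CStarAlgebra 𝔸]
variable (τ : 𝔸 →L[ℂ] ℂ)

/-! ## §1 `τ` through real block means and rotations -/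

section Helpers

omit [CStarAlgebra 𝔸] in
/-- Real scalars pass through a `ℂ`-linear functional. [folklore] -/
private theorem apply_real_smul {𝔹 : Type*} [CStarAlgebra 𝔹] (τ : 𝔹 →L[ℂ] ℂ) (c : ℝ) (a : 𝔹) : τ (c • a) = (c : ℂ) • τ a := by
  rw [RCLike.real_smul_eq_coe_smul (K := ℂ) c a, map_smul]; rfl

/-- A tracial `τ` is invariant under the rotations `cj h m = h m h⁻¹` (56). [cite: Balaban1985Averaging, (56) p.27, (20) p.21] -/
theorem apply_cj (hτ : ∀ x y : 𝔸, τ (x * y) = τ (y * x)) (h : 𝔸ˣ) (m : 𝔸) : τ (cj h m) = τ m := by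
  rw [cj_apply, mul_assoc, hτ, mul_assoc, Units.inv_mul, mul_one]

/-- **`τ(Q′_jμ) = 0` for `τ`-free `μ`** — the linear averaging (211)–(212) has real weights and unit rotations.
[cite: Balaban1985Averaging, (211)–(212) p.50, (77) p.30] -/
theorem apply_lamAvgG (hτ : ∀ x y : 𝔸, τ (x * y) = τ (y * x)) (L : ℕ) (U₀ : Site d → Fin d → 𝔸ˣ) (f : Site d → 𝔸)
    (hf : ∀ x, τ (f x) = 0) : ∀ (j : ℕ) (z : Site d), τ (lamAvgG L U₀ j f z) = 0 := by
  intro j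
  induction j with
  | zero => intro z; rw [lamAvgG_zero]; exact hf z
  | succ j ih =>
    intro z
    rw [lamAvgG_succ, rlam_apply, bmean_apply, map_sum]
    refine sum_eq_zero fun r _ => ?_
    rw [apply_real_smul, apply_cj τ hτ, ih, smul_zero]

end Helpers

/-! ## §2 Local `H`-valuedness of the averages (79)–(80) on the tower -/

section Local

variable {H : Subgroup 𝔸ˣ} {L : ℕ} {U₀c : Site d → Fin d → 𝔸ˣ} {k : ℕ} {g : Site d → 𝔸ˣ} {β η : ℝ} {j : ℕ} {y : Site d}

/-- **`\overline{R₀g}ᵐ(z) ∈ H` AT THE LEVEL-`m` SITES OF THE TOWER `Bʲ(y)`** from `g(x) ∈ H` on the fine box, `H`-valued averaged levels of the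
background, and (167) for `g` (`βLᵏη ≤ ⅛`): (78)/(80) `\overline{R₀g}^{m+1}(z) = v(Lz)·exp[Σ_x L^{−d} log(v(Lz)⁻¹R(Ū₀ᵐ(Γ_{Lz,x}))v(x))]`, `v = \overline{R₀g}ᵐ`,
where each logarithm is of an element of `H` within `⅛` of `1`, hence `τ`-free ((H2)), so the exponential is in `H` ((H3)); induction along the tower
(`B8Ineq130.smul_mem ∕ block_mem`). [cite: Balaban1985Averaging, (78)–(80) p.30, (166)–(167) p.44, p.20] -/
theorem uavg_mem_tower (hH2 : ∀ g ∈ H, ‖(g : 𝔸) - 1‖ ≤ 1 / 8 → τ (mlog (g : 𝔸)) = 0) (hH3 : ∀ S : 𝔸, τ S = 0 → expUnit S ∈ H)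
    (hL : 1 ≤ L) (hVH : ∀ i < k, ∀ (x : Site d) (κ : Fin d), avgIter L U₀c i x κ ∈ H)
    (h167 : Cond167 L U₀c g k β η) (hη : 0 ≤ η) (hβ : 0 ≤ β) (hs : β * (L : ℝ) ^ k * η ≤ 1 / 8)
    (hg : ∀ x : Site d, tlo L y j ≤ x → x ≤ thi L y j → g x ∈ H) :
    ∀ (m n : ℕ), n + m = j → m ≤ k → ∀ z : Site d, tlo L y n ≤ z → z ≤ thi L y n → uavg L U₀c g m z ∈ H
  | 0, n, hn, _, z, hz, hz' => by
    have hnj : n = j := by omega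
    subst hnj
    rw [uavg_zero]
    exact hg z hz hz'
  | m + 1, n, hmn, hmk, z, hz, hz' => by
    have hLr : (1 : ℝ) ≤ L := by exact_mod_cast hL
    have hmlt : m < k := Nat.lt_of_succ_le hmk
    have ih := uavg_mem_tower hH2 hH3 hL hVH h167 hη hβ hs hg m (n + 1) (by omega) hmlt.le
    obtain ⟨h1, h2⟩ := B8Ineq130.smul_mem hL hz hz'
    rw [uavg_succ, R0avg, savg_apply, R0fun_self]
    refine H.mul_mem (ih _ h1 h2) (hH3 _ ?_)
    rw [Sexp_apply, map_sum]
    refine sum_eq_zero fun r _ => ?_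
    obtain ⟨h3, h4⟩ := B8Ineq130.block_mem hz hz' r
    rw [apply_real_smul, R0fun_self, R0fun_add]
    have hmem : (uavg L U₀c g m ((L : ℤ) • z))⁻¹ *
        Rc (hol (avgIter L U₀c m) ((L : ℤ) • z) (treeWord (boxVec L r))) (uavg L U₀c g m ((L : ℤ) • z + boxVec L r)) ∈ H := by
      refine H.mul_mem (H.inv_mem (ih _ h1 h2)) ?_
      rw [Rc_apply]
      exact H.mul_mem (H.mul_mem (hol_mem_of (hVH m hmlt) _ _) (ih _ h3 h4)) (H.inv_mem (hol_mem_of (hVH m hmlt) _ _))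
    have hnorm : ‖((((uavg L U₀c g m ((L : ℤ) • z))⁻¹ *
        Rc (hol (avgIter L U₀c m) ((L : ℤ) • z) (treeWord (boxVec L r))) (uavg L U₀c g m ((L : ℤ) • z + boxVec L r)) : 𝔸ˣ)) : 𝔸) - 1‖ ≤
        1 / 8 :=
      calc _ ≤ β * (L : ℝ) ^ (m + 1) * η := h167 m hmlt z r
        _ ≤ β * (L : ℝ) ^ k * η := mul_le_mul_of_nonneg_right (mul_le_mul_of_nonneg_left (pow_le_pow_right₀ hLr hmk) hβ) hη
        _ ≤ 1 / 8 := hs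
    rw [hH2 _ hmem hnorm, smul_zero]

end Local

/-! ## §3 On the tower from a `Λ_j`-witness; at `u₁⁻¹` for Theorem 4's inductive `u₁` -/

section Tower

variable [Nontrivial 𝔸]
variable {G H : Subgroup 𝔸ˣ}
variable {L : ℕ} {j : ℕ} {y : Site d} {U₀ : Site d → Fin d → 𝔸ˣ} {α₀ α₃ α₄ : ℝ} {μ : Site d → 𝔸} {u ut : Site d → 𝔸ˣ}

/-- **`τ(C′_j(u, μ)(y′)) = 0` ON THE TOWER FOR ANY `u` WITH A `Λ_j`-WITNESS THAT IS `H`-VALUED ON THE BOX** — the `τ`-sibling of n04-b's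
`B8SectERemainderCovariance.Cnl_negStar_of_witness`, same data and windows: at every level-`m` site `z` of `Bⁿ(y)` (`n + m = j`), for a `τ`-free
`μ` with (207) on `Bʲ(y)`, a `G`-valued `U₀` with (1.33) on `Bʲ(y)` (`G` averaging-closed, `G ≤ H`), `u = ũ` on `Bʲ(y)` with `u` `H`-valued there.
Proof: for the clamped data `(π^*U₀, μ∘π, ũ)` the averaged levels are `G`-valued (Prop. 2), (167) holds for `ũ` and `e^{μ∘π}ũ` ([3] p. 45) and
(204) for their relative averages (Prop. 10), so `ũ′ᵐ(z) ∈ H` by `uavg_mem_tower` and `τ(log ũ′ᵐ(z)) = 0` by (H2), while `τ(Q′_m(μ∘π)(z)) = 0`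
(`apply_lamAvgG`); `C′ = log ũ′ − Q′μ` (213); transfer to the original data by the locality of `ũ′ᵐ` and `Q′_m`.
[cite: Balaban1985RegularSpaces, (1.115) p.96, (1.120) p.96, p.76; Balaban1985Averaging, Prop. 10 p.50, (166)–(167) p.44, (178) p.45, (213) p.50] -/
theorem apply_Cnl_of_witness (hτ : ∀ x y : 𝔸, τ (x * y) = τ (y * x))
    (hH2 : ∀ g ∈ H, ‖(g : 𝔸) - 1‖ ≤ 1 / 8 → τ (mlog (g : 𝔸)) = 0) (hH3 : ∀ S : 𝔸, τ S = 0 → expUnit S ∈ H)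
    (hG : AvgClosed d L G) (hGH : G ≤ H) (hL : 2 ≤ L) (hU₀ : ∀ x κ, U₀ x κ ∈ G)
    (hα : 0 < α₀) (hα3 : C0 d * α₀ ≤ 1 / 3) (hα2 : 2 * α₀ ≤ c2' d L)
    (h33 : pdevOn (tlo L y j) (thi L y j) U₀ < α₀ * (((L : ℝ) ^ j)⁻¹) ^ 2) (hL1 : 1 ≤ L)
    (hW : InLambda L (clampCfg (tlo L y j) (thi L y j) U₀) ut j α₃ (((L : ℝ) ^ j)⁻¹))
    (hu : ∀ x : Site d, tlo L y j ≤ x → x ≤ thi L y j → u x = ut x)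
    (huH : ∀ x : Site d, tlo L y j ≤ x → x ≤ thi L y j → u x ∈ H)
    (hμτ : ∀ x, τ (μ x) = 0) (hα₄ : 0 < α₄) (h177b : ∀ x : Site d, InBox (tlo L y j) (thi L y j) x → ‖μ x‖ < α₄)
    (h177a : ∀ (x : Site d) (κ : Fin d), InBox (tlo L y j) (thi L y j) x → InBox (tlo L y j) (thi L y j) (x + e κ) →
      ‖cj (U₀ x κ) (μ (x + e κ)) - μ x‖ < α₄ * ((L : ℝ) ^ j)⁻¹)
    (hα₃ : 0 ≤ α₃) (hα₃' : α₃ ≤ 1 / 50)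
    (hs₁ : 10 * C6 d * (4 * α₄) ≤ 1) (hs₂ : 3000 * ((d : ℝ) + 1) * L * (4 * α₄) ≤ 1) (hs₃ : C4G d L * (α₀ + α₃ + 4 * α₄) ≤ 1)
    (hs₄ : 1024 * ((d : ℝ) + 1) * ((d : ℝ) + 4) * L ^ 2 * α₀ ≤ 1) (hs₅ : 32 * ((d : ℝ) + 1) ^ 2 * C6 d * L ^ 2 * α₀ ≤ 1)
    (hs₆ : 16 * d * C5' d * C6 d * (L : ℝ) ^ 2 * α₀ ≤ 1)
    (hprod : 2 * C6 d * (α₃ + 4 * α₄) ≤ 1 / 8) (h204w : C6 d * (4 * α₄) ≤ 1 / 8)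
    {m n : ℕ} (hmn : n + m = j) (z : Site d) (hz : tlo L y n ≤ z) (hz' : z ≤ thi L y n) :
    τ (Cnl L U₀ u m μ z) = 0 := by
  have hlohi : ∀ i, tlo L y j i ≤ thi L y j i := B8Ineq130.tlo_le_thi hL1 le_rfl j
  have hUU : ∀ x κ, U₀ x κ ∈ U1 𝔸 := fun x κ => hG.le_U1 (hU₀ x κ)
  have hLr : (1 : ℝ) ≤ L := by exact_mod_cast hL1
  have hLj : (0 : ℝ) < (L : ℝ) ^ j := by positivity
  have hC6 : (2 : ℝ) ≤ C6 d := by unfold C6; linarith [one_le_C5 (d := d)]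
  have hα₄' : α₄ ≤ 1 / 4 := by nlinarith
  -- the extended data
  set U₀c := clampCfg (tlo L y j) (thi L y j) U₀ with hU₀c_def
  set μc : Site d → 𝔸 := fun x => μ (clamp (tlo L y j) (thi L y j) x) with hμc_def
  have hU₀c : ∀ x κ, U₀c x κ ∈ G := clampCfg_mem hU₀
  have h52c : pdev U₀c < α₀ * (((L : ℝ) ^ j)⁻¹) ^ 2 := (pdev_clampCfg_le hlohi hUU).trans_lt h33
  have h₀ : AgreeOn (tlo L y j) (thi L y j) U₀ U₀c := (clampCfg_agree U₀).symm
  -- `G`-valued (hence `H`-valued) averaged levels of the clamped background (Prop. 2 of [3])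
  have hVH : ∀ i < j, ∀ (x : Site d) (κ : Fin d), avgIter L U₀c i x κ ∈ H := fun i hi x κ =>
    hGH ((prop2_explicit L hL hG j U₀c hU₀c hα hα3 hα2 h52c).2 i hi.le x κ)
  -- (167) for the witness and for the product `e^{μ∘π}·ũ`; (204) for `(e^{μ∘π}, ũ)`
  have hη : (0 : ℝ) ≤ ((L : ℝ) ^ j)⁻¹ := by positivity
  have hk : (L : ℝ) ^ j * ((L : ℝ) ^ j)⁻¹ ≤ 1 := by rw [mul_inv_cancel₀ hLj.ne']
  obtain ⟨h176, h177⟩ : SiteBd (fun x => expUnit (μc x)) (4 * α₄) ∧ CovBondBd U₀c (fun x => expUnit (μc x)) (4 * α₄ * ((L : ℝ) ^ j)⁻¹) := by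
    have hη1 : ((L : ℝ) ^ j)⁻¹ ≤ 1 := inv_le_one_of_one_le₀ (one_le_pow₀ hLr)
    have hb : ∀ x : Site d, ‖μc x‖ < α₄ := fun x => h177b _ (clamp_inBox hlohi x)
    have ha : ∀ (x : Site d) (κ : Fin d), ‖cj (U₀c x κ) (μc (x + e κ)) - μc x‖ < α₄ * ((L : ℝ) ^ j)⁻¹ := by
      intro x κ
      by_cases hP : tlo L y j κ ≤ x κ ∧ x κ < thi L y j κ
      · have hx := clamp_inBox hlohi x
        have hxe : InBox (tlo L y j) (thi L y j) (clamp (tlo L y j) (thi L y j) x + e κ) := by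
          rw [← clamp_add_e_of hP]; exact clamp_inBox hlohi _
        simp only [hμc_def, hU₀c_def, clampCfg, hP, and_self, if_true, clamp_add_e_of hP]
        exact h177a _ κ hx hxe
      · simp only [hμc_def, hU₀c_def, clampCfg, hP, if_false, clamp_add_e_of_not (hlohi κ) hP, cj_apply, Units.val_one, inv_one, one_mul,
          mul_one, sub_self, norm_zero]
        positivity
    refine ⟨fun x => ?_, fun x κ => ?_⟩
    · show ‖((expUnit (μc x) : 𝔸ˣ) : 𝔸) - 1‖ ≤ 4 * α₄
      rw [val_expUnit]
      exact (B7Eq214.ineq176_of_207 _ hα₄' (hb x)).le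
    · show ‖((((expUnit (μc x))⁻¹ * Rc (U₀c x κ) (expUnit (μc (x + e κ))) : 𝔸ˣ)) : 𝔸) - 1‖ ≤ 4 * α₄ * ((L : ℝ) ^ j)⁻¹
      rw [Units.val_mul, val_inv_expUnit, val_Rc_eq_cj, val_expUnit, val_expUnit, cj_apply]
      exact (B7Eq214.ineq177_of_207 _ _ _ hα₄' hη1 (hb x) (ha x κ)).le
  obtain ⟨hVl, hPl⟩ := levels_of52 hL hG hU₀c j hα hα3 hα2 h52c
  have hΛprod := inLambda_mul_of_prop10_general hL (fun i hi => hVl i hi.le) (fun i hi => hPl i hi.le) h176 h177 hW hη hk hα.le hα₃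
    hα₃' (by positivity) hs₁ hs₂ hs₃ hs₄ hs₅ hs₆
  have hP10 := prop10_general_of52 hL hG hU₀c hα hα3 hα2 h52c h176 h177 hW hα₃ hα₃' (by positivity) hs₁ hs₂ hs₃ hs₄ hs₅ hs₆
  have h204 : ∀ i ≤ j, ∀ x : Site d, ‖((utilG L U₀c (fun x => expUnit (μc x)) ut i x : 𝔸ˣ) : 𝔸) - 1‖ ≤ 1 / 8 :=
    fun i hi x => ((hP10 i hi).2 x).trans h204w
  have hsβ : α₃ * (L : ℝ) ^ j * ((L : ℝ) ^ j)⁻¹ ≤ 1 / 8 := by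
    rw [mul_assoc, mul_inv_cancel₀ hLj.ne', mul_one]; linarith
  have hsβ' : 2 * C6 d * (α₃ + 4 * α₄) * (L : ℝ) ^ j * ((L : ℝ) ^ j)⁻¹ ≤ 1 / 8 := by
    rw [mul_assoc, mul_inv_cancel₀ hLj.ne', mul_one]; exact hprod
  -- `H`-membership on the box of the witness and of the product `e^{μ∘π}·ũ`
  have hutH : ∀ x : Site d, tlo L y j ≤ x → x ≤ thi L y j → ut x ∈ H := fun x hx hx' => by
    rw [← hu x hx hx']; exact huH x hx hx'
  have hμcτ : ∀ x, τ (μc x) = 0 := fun x => hμτ _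
  have hprodH : ∀ x : Site d, tlo L y j ≤ x → x ≤ thi L y j → ((fun x => expUnit (μc x)) * ut) x ∈ H := fun x hx hx' => by
    rw [Pi.mul_apply]; exact H.mul_mem (hH3 _ (hμcτ x)) (hutH x hx hx')
  -- THE LAW for the clamped data at the tower site `z`: `log ũ′ᵐ(z)` and `Q′_m(μ∘π)(z)` are `τ`-free
  have hglob : τ (Cnl L U₀c ut m μc z) = 0 := by
    have hW1 : utilG L U₀c (fun x => expUnit (μc x)) ut m z ∈ H := by
      rw [congrFun (utilG_eq_uavg_mul_inv L U₀c _ ut m) z]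
      exact H.mul_mem
        (uavg_mem_tower τ hH2 hH3 hL1 hVH hΛprod.2 hη (by positivity) hsβ' hprodH m n hmn (by omega) z hz hz')
        (H.inv_mem (uavg_mem_tower τ hH2 hH3 hL1 hVH hW.2 hη hα₃ hsβ hutH m n hmn (by omega) z hz hz'))
    simp only [Cnl, Qnl_eq_mlog_utilG, qprimeIter_bgT_eq_lamAvgG, map_sub]
    rw [hH2 _ hW1 (h204 m (by omega) z), apply_lamAvgG τ hτ L U₀c μc hμcτ m z, sub_zero]
  -- transfer to the original data on the tower
  have hC : ∀ {ν νc : Site d → 𝔸}, (∀ x : Site d, tlo L y j ≤ x → x ≤ thi L y j → ν x = νc x) →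
      Cnl L U₀ u m ν z = Cnl L U₀c ut m νc z := by
    intro ν νc hν
    have hu' : ∀ x : Site d, tlo L y j ≤ x → x ≤ thi L y j → (fun x => expUnit (ν x)) x = (fun x => expUnit (νc x)) x :=
      fun x hx hx' => by simp only [hν x hx hx']
    simp only [Cnl, Qnl_eq_mlog_utilG]
    rw [qprimeIter_bgT_eq_lamAvgG L U₀ ν m, qprimeIter_bgT_eq_lamAvgG L U₀c νc m,
      utilG_congr_tower hL1 h₀ hu' hu m n hmn z hz hz', lamAvgG_congr_tower hL1 h₀ hν m n hmn z hz hz']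
  have hμ : ∀ x : Site d, tlo L y j ≤ x → x ≤ thi L y j → μ x = μc x :=
    fun x hx hx' => by simp only [hμc_def, clamp_of_inBox (inBox_of_le hx hx')]
  rw [hC hμ]
  exact hglob

/-- ★ **THE BINDER `hCτ` OF `B8SectETraceFree` AS A THEOREM** — the `τ`-sibling of n04-b's `Cnl_negStar_inv_of_axial`: for Theorem 4's inductive
`u₁` (`U₁^{u₁}U₀ ∈ Ax_k(𝔅_k, U₀)` and (1.29); `U₁ = e^{B}` unitary-valued with (1.69) on the towers; the full gauge-fixed field's regularity `αP`;
windows as there), a `G`-VALUED background `U₀` (`G` averaging-closed, `G ≤ H`, `G ≤ U(𝔸)`) and an `H`-VALUED `u₁`, where `H` carries (H2) «`τ(log h) = 0`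
for `h ∈ H`, `‖h − 1‖ ≤ ⅛`» and (H3) «`e^{S} ∈ H` for `τ`-free `S`» (for `M_N(ℂ)`: `G = SU(N)`, `H = SL(N, ℂ)`, `τ = tr`): at every `j ≤ k`, `y ∈ Λ_j` and
every `τ`-free `μ` in the (1.120)-set of the tower `Bʲ(y)`, `τ(C′_j(u₁⁻¹, μ)(y)) = 0`.
[cite: Balaban1985RegularSpaces, (1.115) p.96, (1.120) p.96, p.76, (1.112) p.95; Balaban1985Averaging, p.20, Prop. 10 p.50, (213) p.50] -/
theorem apply_Cnl_inv_of_axial (hτ : ∀ x y : 𝔸, τ (x * y) = τ (y * x))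
    (hH2 : ∀ g ∈ H, ‖(g : 𝔸) - 1‖ ≤ 1 / 8 → τ (mlog (g : 𝔸)) = 0) (hH3 : ∀ S : 𝔸, τ S = 0 → expUnit S ∈ H)
    (hG : AvgClosed d L G) (hGH : G ≤ H) (hGu : G ≤ unitaryUnits 𝔸)
    {k : ℕ} (Λ : ℕ → Set (Site d)) {c αP : ℝ} {B : Site d → Fin d → 𝔸} {u₁ : Site d → 𝔸ˣ}
    (hd : 1 ≤ d) (hL : 2 ≤ L) (hL1 : 1 ≤ L) (hU₀ : ∀ x κ, U₀ x κ ∈ G) (hu₁ : ∀ x, u₁ x ∈ H)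
    (hα : 0 < α₀) (hα3 : C0 d * α₀ ≤ 1 / 3) (hα4 : 4 * α₀ ≤ c2' d L) (hc : 0 ≤ c) (hα₄ : 0 < α₄)
    (hαP : 0 < αP) (hαP3 : C0 d * αP ≤ 1 / 3) (hαP2 : 2 * αP ≤ c2' d L)
    (hBu : ∀ (x : Site d) (κ : Fin d), expCfg B x κ ∈ unitaryUnits 𝔸)
    (h33 : ∀ j, j ≤ k → ∀ y ∈ Λ j, pdevOn (tlo L y j) (thi L y j) U₀ < α₀ * (((L : ℝ) ^ j)⁻¹) ^ 2)
    (h69 : ∀ j, j ≤ k → ∀ y ∈ Λ j, ∀ (x : Site d) (κ : Fin d), InBox (tlo L y j) (thi L y j) x →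
      InBox (tlo L y j) (thi L y j) (x + e κ) → ‖B x κ‖ ≤ c * ((L : ℝ) ^ j)⁻¹)
    (hP : ∀ j, j ≤ k → ∀ y ∈ Λ j, pdevOn (tlo L y j) (thi L y j) (expCfg B * U₀) < αP * (((L : ℝ) ^ j)⁻¹) ^ 2)
    (hAx : InAx L k Λ U₀ (mgauge U₀ u₁ (expCfg B) * U₀)) (h129 : Restr129 L k Λ U₀ u₁)
    (hsmall : Real.exp (4 * (800 * ((d : ℝ) + 1) ^ 2 * ((d : ℝ) + 4)) * α₀) * (1 + 8 * (131072 * ((d : ℝ) + 1) ^ 2) * c) ≤ 2)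
    (hc₃ : 2 * c ≤ c3 d L) (hsc : 2048 * (d : ℝ) * c ≤ 1) (hα₃' : 40 * d * c ≤ 1 / 50)
    (hs₁ : 10 * C6 d * (4 * α₄) ≤ 1) (hs₂ : 3000 * ((d : ℝ) + 1) * L * (4 * α₄) ≤ 1)
    (hs₃ : C4G d L * (α₀ + 40 * d * c + 4 * α₄) ≤ 1)
    (hs₄ : 1024 * ((d : ℝ) + 1) * ((d : ℝ) + 4) * L ^ 2 * α₀ ≤ 1) (hs₅ : 32 * ((d : ℝ) + 1) ^ 2 * C6 d * L ^ 2 * α₀ ≤ 1)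
    (hs₆ : 16 * d * C5' d * C6 d * (L : ℝ) ^ 2 * α₀ ≤ 1)
    (hprod : 2 * C6 d * (40 * d * c + 4 * α₄) ≤ 1 / 8) (h204w : C6 d * (4 * α₄) ≤ 1 / 8) :
    ∀ j, j ≤ k → ∀ y ∈ Λ j, ∀ μ : Site d → 𝔸, (∀ x, τ (μ x) = 0) →
      (∀ x : Site d, InBox (tlo L y j) (thi L y j) x → ‖μ x‖ < α₄) →
      (∀ (x : Site d) (κ : Fin d), InBox (tlo L y j) (thi L y j) x → InBox (tlo L y j) (thi L y j) (x + e κ) →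
        ‖cj (U₀ x κ) (μ (x + e κ)) - μ x‖ < α₄ * ((L : ℝ) ^ j)⁻¹) →
      τ (Cnl L U₀ u₁⁻¹ j μ y) = 0 := by
  intro j hj y hy μ hμτ hμb hμa
  have hU₀u : ∀ x κ, U₀ x κ ∈ unitaryUnits 𝔸 := fun x κ => hGu (hU₀ x κ)
  obtain ⟨ut', -, hW, hag⟩ := witness_inv_unitary_of_glev hd hL hU₀u hα hα3 hα4 (h33 j hj y hy) hc hsmall hc₃ hsc hαP hαP3 hαP2 hL1
    hBu (h69 j hj y hy) (hP j hj y hy) (glev_on_towers_of_axial hL1 Λ hAx h129 j hj y hy)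
  have huH : ∀ x : Site d, tlo L y j ≤ x → x ≤ thi L y j → u₁⁻¹ x ∈ H := fun x _ _ => by
    rw [Pi.inv_apply]; exact H.inv_mem (hu₁ x)
  have hy₀ : tlo L y 0 ≤ y := by rw [tlo_zero]
  have hy₀' : y ≤ thi L y 0 := by rw [thi_zero]
  exact apply_Cnl_of_witness τ hτ hH2 hH3 hG hGH hL hU₀ hα hα3 (by linarith) (h33 j hj y hy) hL1 hW hag huH hμτ hα₄ hμb hμa (by positivity)
    hα₃' hs₁ hs₂ hs₃ hs₄ hs₅ hs₆ hprod h204w (m := j) (n := 0) (by omega) y hy₀ hy₀'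

end Tower

#print axioms apply_Cnl_inv_of_axial

end Literature.MathematicalPhysics.QuantumFieldTheory.Balaban1983to89.B8SectERemainderTraceFree

end
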